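import Summits.HodgeConjecture.CorCM.OcticWeilFourfoldPowersHodgeOfMarkman
import Summits.HodgeConjecture.CorCM.OcticCurveFourfoldHodgeOfMarkman
import HarnessLib

/-!
# COR-CM — the Hodge conjecture for every product of copies of a CM abelian FOURFOLD `B` of WEIL TYPE (octic CM field
# `K ⊇ k`, `k`-signature `(2,2)`, quartic part `2`-transitive) and the CM elliptic curve `E` of `k`, GIVEN ONLY Markman's
# fourfold theorem: the INTRINSIC form (no frame in the statement)

Cell `pub-hodgecm2` (COR-CM), seat b30 gen 19 (2026-08-21); count-neutral own lane OCTIC-WEIL22.  Theorems only, no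
definition, no named fact, no `sorry`.  HONEST FRAMING: CONDITIONAL on the single displayed named fact
`HodgeTheory.Markman2025_weilClasses_algebraic_abelianFourfold` (E. Markman, arXiv:2502.03415 / 2509.23403 Thm. 1.2,
UNREFEREED — typed in the tree as a record, not proved); `HC_CM` is not asserted.

* §1 `exists_frame₂` — for `[K:ℚ] = 8`, `i : k → K`, `Hom(k, ℂ) = {τ, τ̄}` and a CM type `Φ` with EXACTLY TWO members over
  `τ`, an enumeration `e : Hom(K, ℂ) ≃ Fin 4 × Bool` with `(e s).2 = [s ∘ i = τ]`, `e s̄ = ((e s).1, ¬(e s).2)` and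
  `Φ = e⁻¹ phi₂` (`phi₂ = {(0,true), (1,true), (2,false), (3,false)}`) — pure counting (gen 18's `exists_frame` with two
  swaps); `h2t_of_twoTransitive` — the frame's `2`-transitivity hypothesis from the intrinsic one.
* §2 **`hodgeConjectureFor_biproduct_comp_vec_of_markman₂`**: `K` ANY CM field of degree `8`, `k` quadratic, `i : k → K`,
  `B ⊨ (K; Φ)`, `E ⊨ (k; Ψ)` with `τ ∈ Ψ`, `#{s ∈ Φ | s ∘ i = τ} = 2` (`k`-signature `(2,2)`: `B` is of Weil type for `k`),
  and `Aut(ℂ)` `2`-TRANSITIVE on the four embeddings of `K` over `τ` (`h2T`; by Dodson 1984 §3.3.2 this holds whenever `B`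
  is SIMPLE — sequel `CorCM/OcticWeilFourfoldTwoTransitiveOfSimple.lean`) ⟹ `HodgeConjectureFor (⨁_j ![B, E] (κ j))` for
  EVERY `κ : Fin N → Fin 2`; `…_of_avDominatedBy_…` for everything dominated.  No `√-d` datum is needed (Markman's theorem
  enters through the cell's `CMWeights.weightClassesAlg_le_algebraicClasses_two_of_markman`).
[cite: Markman2025SurveySecant, Thm. 1.2] [cite: Pohlmann1968, Thm 1] [cite: Dodson1984, §3.3.2 Theorem]
[cite: MoonenZarhin1995Duke, Thm. 2.4] [cite: Gordon1999HodgeAVSurvey, 5.13 (ii)] [cite: MumfordAV1970, §19]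

## References
* [Markman2025SurveySecant] E. Markman, arXiv:2509.23403, Thm. 1.2, §1.1.  [Pohlmann1968] H. Pohlmann, Ann. of Math. 88
  (1968), Thm 1.  [Dodson1984] B. Dodson, Trans. AMS 283 (1984), §3.1.1, §3.3.2 Theorem.  [MoonenZarhin1995Duke] B. Moonen,
  Yu. Zarhin, Duke Math. J. 77 (1995), Thm. 2.4.  [Gordon1999HodgeAVSurvey] B. B. Gordon, CRM Monogr. 10 (1999), 5.13 (ii).
  [Shimura1998] G. Shimura, *Abelian varieties with complex multiplication*, §18.2 Lemma.  [MumfordAV1970] §19.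
-/

noncomputable section

open CategoryTheory CategoryTheory.Limits NumberField

namespace Summit.HodgeConjecture.CorCM.OcticWeilFourfold

open Literature.AlgebraicGeometry Literature.AlgebraicGeometry.Motives Literature.AlgebraicGeometry.HodgeTheory
open Literature.AlgebraicGeometry.ComplexMultiplication (IsCMTypeRealisation)
open Literature.AlgebraicTopology.SingularHomology
open Summit.HodgeConjecture.CorCM.Census.OcticCurveFourfold (Pt)
open Summit.HodgeConjecture.CorCM.Census.OcticWeilFourfold (phi₂ phi₂Pre inr_mem_phi₂Pre)
open Summit.HodgeConjecture.CorCM.OcticCurveFourfold (card_filter_comp_eq_four comp_injective)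
open Summit.HodgeConjecture.CorCM.DecicCurveFivefold (curveSlots₂)
open Summit.HodgeConjecture.CorCM.NonGaloisField (conjugate_comp)

open scoped Classical

/-! ## §1 The frame exists (pure counting); the frame's `2`-transitivity from the intrinsic one -/

section Frame

variable {K : Type} [Field K] [NumberField K] {k : Type} [Field k] [NumberField k]

/-- **THE FRAME EXISTS.**  For `[K:ℚ] = 8`, `i : k → K`, `Hom(k, ℂ) = {τ, τ̄}` and a CM type `Φ` of `K` with exactly two
members `sP ≠ sQ` over `τ`, there is an enumeration `e : Hom(K, ℂ) ≃ Fin 4 × Bool` with `(e s).2 = [s ∘ i = τ]`,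
`e s̄ = ((e s).1, ¬(e s).2)` and `Φ = e⁻¹ phi₂` (`phi₂ = {(0,true), (1,true)} ⊔ {(a,false) | a ∉ {0,1}}`): number the four
embeddings over `τ` with `sP ↦ 0`, `sQ ↦ 1` (two transpositions) and give `s̄` the number of `s`. [cite: Shimura1998, §18.2 Lemma] -/
theorem exists_frame₂ (h8 : Module.finrank ℚ K = 8) (h2 : Module.finrank ℚ k = 2) (i : k →+* K) {τ : k →+* ℂ}
    (hττ : ComplexEmbedding.conjugate τ ≠ τ) (hk : ∀ σ : k →+* ℂ, σ = τ ∨ σ = ComplexEmbedding.conjugate τ)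
    (Φ : CMType K) (h2c : (Finset.univ.filter fun s : K →+* ℂ => s.comp i = τ ∧ s ∈ Φ.1).card = 2) :
    ∃ e : (K →+* ℂ) ≃ Fin 4 × Bool, (∀ s, (e s).2 = true ↔ s.comp i = τ) ∧
      (∀ s, e (ComplexEmbedding.conjugate s) = ((e s).1, !(e s).2)) ∧ ∀ s, s ∈ Φ.1 ↔ Sum.inr (e s) ∈ phi₂ := by
  -- the members `sP ≠ sQ` of `Φ` over `τ`
  obtain ⟨sP, sQ, hPQ, hPQeq⟩ := Finset.card_eq_two.1 h2c
  have hsPmem : sP.comp i = τ ∧ sP ∈ Φ.1 := by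
    have h : sP ∈ Finset.univ.filter fun s : K →+* ℂ => s.comp i = τ ∧ s ∈ Φ.1 := by rw [hPQeq]; simp
    exact (Finset.mem_filter.1 h).2
  have hsQmem : sQ.comp i = τ ∧ sQ ∈ Φ.1 := by
    have h : sQ ∈ Finset.univ.filter fun s : K →+* ℂ => s.comp i = τ ∧ s ∈ Φ.1 := by rw [hPQeq]; simp
    exact (Finset.mem_filter.1 h).2
  have huniq : ∀ s : K →+* ℂ, s.comp i = τ → (s ∈ Φ.1 ↔ s = sP ∨ s = sQ) := by
    intro s hs
    constructor
    · intro hΦ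
      have h : s ∈ Finset.univ.filter fun s : K →+* ℂ => s.comp i = τ ∧ s ∈ Φ.1 := Finset.mem_filter.2 ⟨by simp, hs, hΦ⟩
      rw [hPQeq, Finset.mem_insert, Finset.mem_singleton] at h
      exact h
    · rintro (rfl | rfl)
      · exact hsPmem.2
      · exact hsQmem.2
  -- the four embeddings over `τ`, numbered with `sP ↦ 0`, `sQ ↦ 1`
  set F : Finset (K →+* ℂ) := Finset.univ.filter fun s : K →+* ℂ => s.comp i = τ with hFdef
  have hF : F.card = 4 := card_filter_comp_eq_four i h8 h2 τ
  let f : {s // s ∈ F} ≃ Fin 4 := F.equivFinOfCardEq hF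
  have hsPF : sP ∈ F := Finset.mem_filter.2 ⟨Finset.mem_univ _, hsPmem.1⟩
  have hsQF : sQ ∈ F := Finset.mem_filter.2 ⟨Finset.mem_univ _, hsQmem.1⟩
  let g₁ : {s // s ∈ F} ≃ Fin 4 := f.trans (Equiv.swap (f ⟨sP, hsPF⟩) 0)
  have hg₁P : g₁ ⟨sP, hsPF⟩ = 0 := by simp [g₁]
  have hg₁Q : g₁ ⟨sQ, hsQF⟩ ≠ 0 := by
    rw [← hg₁P]
    intro h
    exact hPQ.symm (congrArg Subtype.val (g₁.injective h))
  let g : {s // s ∈ F} ≃ Fin 4 := g₁.trans (Equiv.swap (g₁ ⟨sQ, hsQF⟩) 1)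
  have hgP : g ⟨sP, hsPF⟩ = 0 := by
    change Equiv.swap (g₁ ⟨sQ, hsQF⟩) 1 (g₁ ⟨sP, hsPF⟩) = 0
    rw [hg₁P, Equiv.swap_apply_of_ne_of_ne hg₁Q.symm (by decide)]
  have hgQ : g ⟨sQ, hsQF⟩ = 1 := by
    change Equiv.swap (g₁ ⟨sQ, hsQF⟩) 1 (g₁ ⟨sQ, hsQF⟩) = 1
    rw [Equiv.swap_apply_left]
  have hmemF : ∀ s : K →+* ℂ, s ∈ F ↔ s.comp i = τ := fun s => by simp [hFdef]
  -- `g s ∈ {0, 1} ↔ s ∈ Φ` on the fibre of `τ`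
  have hg01 : ∀ (s : K →+* ℂ) (hs : s ∈ F), (g ⟨s, hs⟩ = 0 ∨ g ⟨s, hs⟩ = 1) ↔ s ∈ Φ.1 := by
    intro s hs
    rw [huniq s ((hmemF s).1 hs)]
    constructor
    · rintro (h | h)
      · left
        have h0 : g ⟨s, hs⟩ = g ⟨sP, hsPF⟩ := by rw [h, hgP]
        exact congrArg Subtype.val (g.injective h0)
      · right
        have h0 : g ⟨s, hs⟩ = g ⟨sQ, hsQF⟩ := by rw [h, hgQ]
        exact congrArg Subtype.val (g.injective h0)
    · rintro (rfl | rfl)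
      · exact Or.inl hgP
      · exact Or.inr hgQ
  -- over `τ̄` the conjugate lies over `τ`
  have hconj_over : ∀ s : K →+* ℂ, ¬ s.comp i = τ → (ComplexEmbedding.conjugate s).comp i = τ := by
    intro s hs
    rw [conjugate_comp, (hk (s.comp i)).resolve_left hs, ComplexEmbedding.involutive_conjugate]
  have hconj_over' : ∀ s : K →+* ℂ, s.comp i = τ → ¬ (ComplexEmbedding.conjugate s).comp i = τ := by
    intro s hs h
    rw [conjugate_comp, hs] at h
    exact hττ h
  -- the enumeration
  let toF : (K →+* ℂ) → Fin 4 × Bool := fun s =>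
    if h : s.comp i = τ then (g ⟨s, (hmemF s).2 h⟩, true)
    else (g ⟨ComplexEmbedding.conjugate s, (hmemF _).2 (hconj_over s h)⟩, false)
  let ofF : Fin 4 × Bool → (K →+* ℂ) := fun p =>
    if p.2 then (g.symm p.1).1 else ComplexEmbedding.conjugate (g.symm p.1).1
  have hgF : ∀ a : Fin 4, ((g.symm a).1).comp i = τ := fun a => (hmemF _).1 (g.symm a).2
  have hcc : ∀ s : K →+* ℂ, ComplexEmbedding.conjugate (ComplexEmbedding.conjugate s) = s :=
    ComplexEmbedding.involutive_conjugate K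
  have hgcongr : ∀ (s t : K →+* ℂ) (hs : s ∈ F) (ht : t ∈ F), s = t → g ⟨s, hs⟩ = g ⟨t, ht⟩ := by
    rintro s t hs ht rfl; rfl
  have htoF_pos : ∀ s (h : s.comp i = τ), toF s = (g ⟨s, (hmemF s).2 h⟩, true) := fun s h => dif_pos h
  have htoF_neg : ∀ s (h : ¬ s.comp i = τ),
      toF s = (g ⟨ComplexEmbedding.conjugate s, (hmemF _).2 (hconj_over s h)⟩, false) := fun s h => dif_neg h
  have htoF_of : ∀ p, toF (ofF p) = p := by
    rintro ⟨a, b⟩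
    cases b
    · have hof : ofF (a, false) = ComplexEmbedding.conjugate (g.symm a).1 := rfl
      have h : ¬ (ComplexEmbedding.conjugate (g.symm a).1).comp i = τ := hconj_over' _ (hgF a)
      rw [hof, htoF_neg _ h, Prod.mk.injEq]
      refine ⟨?_, rfl⟩
      rw [hgcongr _ _ _ (g.symm a).2 (hcc _), Subtype.coe_eta, Equiv.apply_symm_apply]
    · have hof : ofF (a, true) = (g.symm a).1 := rfl
      rw [hof, htoF_pos _ (hgF a), Prod.mk.injEq]
      exact ⟨by rw [Subtype.coe_eta, Equiv.apply_symm_apply], rfl⟩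
  have hof_toF : ∀ s, ofF (toF s) = s := by
    intro s
    by_cases h : s.comp i = τ
    · rw [htoF_pos s h]
      change (g.symm (g ⟨s, _⟩)).1 = s
      rw [Equiv.symm_apply_apply]
    · rw [htoF_neg s h]
      change ComplexEmbedding.conjugate (g.symm (g ⟨ComplexEmbedding.conjugate s, _⟩)).1 = s
      rw [Equiv.symm_apply_apply]
      exact hcc s
  let e : (K →+* ℂ) ≃ Fin 4 × Bool := ⟨toF, ofF, hof_toF, htoF_of⟩
  have he : ∀ s, e s = toF s := fun _ => rfl
  refine ⟨e, fun s => ?_, fun s => ?_, fun s => ?_⟩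
  · -- signs
    rw [he]
    by_cases h : s.comp i = τ
    · rw [htoF_pos s h]; exact ⟨fun _ => h, fun _ => rfl⟩
    · rw [htoF_neg s h]; exact ⟨fun h' => absurd h' Bool.false_ne_true, fun h' => absurd h' h⟩
  · -- conjugation
    rw [he, he]
    by_cases h : s.comp i = τ
    · have h' : ¬ (ComplexEmbedding.conjugate s).comp i = τ := hconj_over' s h
      rw [htoF_pos s h, htoF_neg _ h', Prod.mk.injEq]
      exact ⟨hgcongr _ _ _ _ (hcc s), rfl⟩
    · have h' : (ComplexEmbedding.conjugate s).comp i = τ := hconj_over s h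
      rw [htoF_neg s h, htoF_pos _ h']
      rfl
  · -- the type
    rw [he, phi₂, inr_mem_phi₂Pre]
    by_cases h : s.comp i = τ
    · rw [htoF_pos s h, ← hg01 s ((hmemF s).2 h)]
      constructor
      · intro h01
        exact Or.inl ⟨rfl, h01⟩
      · rintro (⟨-, h01⟩ | ⟨hb, -⟩)
        · exact h01
        · simp at hb
    · have hc : (ComplexEmbedding.conjugate s).comp i = τ := hconj_over s h
      rw [htoF_neg s h, Φ.2 s, ← hg01 _ ((hmemF _).2 hc)]
      constructor
      · intro hno
        right
        exact ⟨rfl, fun h0 => hno (Or.inl h0), fun h1 => hno (Or.inr h1)⟩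
      · rintro (⟨hb, -⟩ | ⟨-, h0, h1⟩)
        · simp at hb
        · rintro (h | h)
          · exact h0 h
          · exact h1 h

omit [NumberField K] [NumberField k] in
/-- **The frame's `2`-transitivity from the intrinsic one**: if `Aut(ℂ)` is `2`-transitive on the embeddings of `K` over
`τ`, then for all pairs `a ≠ b` some `ρ` maps `e⁻¹(a,true) ↦ e⁻¹(0,true)` and `e⁻¹(b,true) ↦ e⁻¹(1,true)`.
[cite: Dodson1984, §3.3.2 Theorem] -/
theorem h2t_of_twoTransitive {i : k →+* K} {τ : k →+* ℂ} {e : (K →+* ℂ) ≃ Fin 4 × Bool}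
    (he_sign : ∀ s, (e s).2 = true ↔ s.comp i = τ)
    (h2T : ∀ s t s' t' : K →+* ℂ, s.comp i = τ → t.comp i = τ → s'.comp i = τ → t'.comp i = τ → s ≠ t → s' ≠ t' →
      ∃ ρ : ℂ ≃+* ℂ, (ρ : ℂ →+* ℂ).comp s = s' ∧ (ρ : ℂ →+* ℂ).comp t = t') :
    ∀ a b : Fin 4, a ≠ b → ∃ ρ : ℂ ≃+* ℂ,
      (ρ : ℂ →+* ℂ).comp (e.symm (a, true)) = e.symm (0, true) ∧ (ρ : ℂ →+* ℂ).comp (e.symm (b, true)) = e.symm (1, true) := by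
  intro a b hab
  have hover : ∀ c : Fin 4, (e.symm (c, true)).comp i = τ := fun c => (he_sign _).1 (by rw [Equiv.apply_symm_apply])
  refine h2T _ _ _ _ (hover a) (hover b) (hover 0) (hover 1) (fun h => hab ?_) (fun h => ?_)
  · have := e.symm.injective h
    exact (Prod.mk.inj this).1
  · have := e.symm.injective h
    exact absurd (Prod.mk.inj this).1 (by decide)

end Frame

/-! ## §2 The intrinsic theorem -/

section Main

variable {K : Type} [Field K] [NumberField K] [IsCMField K] {k : Type} [Field k] [NumberField k] [IsCMField k]
  {N : ℕ} {Φ : CMType K} {B : AbelianVariety ℂ} {ιB : 𝓞 K →+* End B} {θB : K →+* Module.End ℂ (complexBetti B.X 1)}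
  {Ψ : CMType k} {E : AbelianVariety ℂ} {ιE : 𝓞 k →+* End E} {θE : k →+* Module.End ℂ (complexBetti E.X 1)}

/-- **THE HODGE CONJECTURE FOR EVERY PRODUCT OF COPIES OF `B` AND `E`, GIVEN ONLY Markman's fourfold theorem.**  `K` ANY
CM field of degree `8`, `k` quadratic with `i : k → K`; `B ⊨ (K; Φ)` a CM abelian fourfold and `E ⊨ (k; Ψ)` a CM elliptic
curve (realisations on `H¹`), with `τ ∈ Ψ`, `#{s ∈ Φ | s ∘ i = τ} = 2` (`k`-signature `(2,2)`: `B` is an abelian fourfold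
of WEIL TYPE for `k`), and `Aut(ℂ)` `2`-TRANSITIVE on the four embeddings of `K` over `τ` (`h2T` — Dodson: automatic for
SIMPLE `B`).  Then for every `κ : Fin N → Fin 2`, every rational `(q,q)`-class on `⨁_j ![B, E] (κ j)` (`B^n × E^a`, any
order) is algebraic.  Proof: `exists_frame₂`, `h2t_of_twoTransitive`, and the frame form
`hodgeConjectureFor_biproduct_comp_of_frame₂_of_markman` at `Kf = (k, K)`.  Displayed leaf:
`Markman2025_weilClasses_algebraic_abelianFourfold` (UNREFEREED); nothing else. [cite: Markman2025SurveySecant, Thm. 1.2]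
[cite: Pohlmann1968, Thm 1] [cite: Dodson1984, §3.3.2 Theorem] [cite: MoonenZarhin1995Duke, Thm. 2.4] -/
theorem hodgeConjectureFor_biproduct_comp_vec_of_markman₂
    (hW4 : Markman2025_weilClasses_algebraic_abelianFourfold)
    (h8 : Module.finrank ℚ K = 8) (h2 : Module.finrank ℚ k = 2) (i : k →+* K)
    (hB : IsCMTypeRealisation Φ B ιB θB) (hE : IsCMTypeRealisation Ψ E ιE θE)
    {τ : k →+* ℂ} (hτΨ : τ ∈ Ψ.1)
    (h22 : (Finset.univ.filter fun s : K →+* ℂ => s.comp i = τ ∧ s ∈ Φ.1).card = 2)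
    (h2T : ∀ s t s' t' : K →+* ℂ, s.comp i = τ → t.comp i = τ → s'.comp i = τ → t'.comp i = τ → s ≠ t → s' ≠ t' →
      ∃ ρ : ℂ ≃+* ℂ, (ρ : ℂ →+* ℂ).comp s = s' ∧ (ρ : ℂ →+* ℂ).comp t = t')
    (κ : Fin N → Fin 2) :
    HodgeConjectureFor (⨁ fun j => (![B, E] : Fin 2 → AbelianVariety ℂ) (κ j)).dim
      (⨁ fun j => (![B, E] : Fin 2 → AbelianVariety ℂ) (κ j)).X := by
  have hττ : ComplexEmbedding.conjugate τ ≠ τ := QuarticCM.conjugate_ne τ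
  have hk : ∀ σ : k →+* ℂ, σ = τ ∨ σ = ComplexEmbedding.conjugate τ := fun σ =>
    QuarticCM.eq_or_eq_conjugate_of_quadratic h2 τ σ
  have hΨ : ∀ σ : k →+* ℂ, σ ∈ Ψ.1 ↔ σ = τ := by
    intro σ
    rcases hk σ with rfl | rfl
    · exact ⟨fun _ => rfl, fun _ => hτΨ⟩
    · exact ⟨fun h => absurd h ((Ψ.2 τ).1 hτΨ), fun h => absurd h hττ⟩
  obtain ⟨e, he_sign, he_conj, hΦ⟩ := exists_frame₂ h8 h2 i hττ hk Φ h22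
  have h2t := h2t_of_twoTransitive he_sign h2T
  -- the two-slot family `Kf = (k, K)`
  let Kf : Fin 2 → Type := Fin.cons k fun _ : Fin 1 => K
  letI instF : ∀ j, Field (Kf j) := fun j =>
    Fin.cases (motive := fun j => Field (Kf j)) ‹Field k› (fun _ => ‹Field K›) j
  letI instN : ∀ j, NumberField (Kf j) := fun j =>
    Fin.cases (motive := fun j => NumberField (Kf j)) ‹NumberField k› (fun _ => ‹NumberField K›) j
  haveI instC : ∀ j, IsCMField (Kf j) := fun j =>
    Fin.cases (motive := fun j => IsCMField (Kf j)) ‹IsCMField k› (fun _ => ‹IsCMField K›) j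
  exact hodgeConjectureFor_biproduct_comp_of_frame₂_of_markman (Kf := Kf) (i₀ := 0) (i₁ := 1)
    (A₂ := ![B, E]) (Φ₂ := Fin.cons Φ (Fin.cons Ψ finZeroElim)) (ι₂ := Fin.cons ιB (Fin.cons ιE finZeroElim))
    (θ₂ := Fin.cons θB (Fin.cons θE finZeroElim)) hW4 κ h8 h2 i
    (Fin.cases hB (Fin.cases hE fun l => l.elim0)) e he_sign he_conj hΦ hΨ h2t

/-- **The Hodge conjecture for every abelian variety dominated by a product of copies of `B` and `E`** (intrinsic form,
modulo Markman's fourfold theorem): everything isogenous to an abelian subvariety or quotient of some `B^n × E^a`.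
[cite: Markman2025SurveySecant, Thm. 1.2] [cite: MumfordAV1970, §19] -/
theorem hodgeConjectureFor_of_avDominatedBy_comp_vec_of_markman₂
    (hW4 : Markman2025_weilClasses_algebraic_abelianFourfold)
    (h8 : Module.finrank ℚ K = 8) (h2 : Module.finrank ℚ k = 2) (i : k →+* K)
    (hB : IsCMTypeRealisation Φ B ιB θB) (hE : IsCMTypeRealisation Ψ E ιE θE)
    {τ : k →+* ℂ} (hτΨ : τ ∈ Ψ.1)
    (h22 : (Finset.univ.filter fun s : K →+* ℂ => s.comp i = τ ∧ s ∈ Φ.1).card = 2)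
    (h2T : ∀ s t s' t' : K →+* ℂ, s.comp i = τ → t.comp i = τ → s'.comp i = τ → t'.comp i = τ → s ≠ t → s' ≠ t' →
      ∃ ρ : ℂ ≃+* ℂ, (ρ : ℂ →+* ℂ).comp s = s' ∧ (ρ : ℂ →+* ℂ).comp t = t')
    (κ : Fin N → Fin 2)
    {C : AbelianVariety ℂ} (hC : Domination.AVDominatedBy C (⨁ fun j => (![B, E] : Fin 2 → AbelianVariety ℂ) (κ j))) :
    HodgeConjectureFor C.dim C.X :=
  Domination.hodgeConjectureFor_of_avDominatedBy
    (hodgeConjectureFor_biproduct_comp_vec_of_markman₂ hW4 h8 h2 i hB hE hτΨ h22 h2T κ) hC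

end Main

end Summit.HodgeConjecture.CorCM.OcticWeilFourfold

end
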